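import Literature.NumberTheory.EllipticCurves.FormalGroupLawAssocIntegralProofs
import Literature.NumberTheory.EllipticCurves.FormalGroupLogHomProofs
import Literature.NumberTheory.EllipticCurves.FormalGroupLogSummableProofs
import Literature.NumberTheory.EllipticCurves.FormalGroupHasseInvariantProofs
import Literature.NumberTheory.EllipticCurves.PadicPointsFiltrationProofs
import Literature.NumberTheory.EllipticCurves.FormalGroupDenominators
import Mathlib.RingTheory.PowerSeries.Derivative
import HarnessLib

/-!
# The multiplication-by-`n` maps `[n](t)` of the formal group of a Weierstrass curve
# (Silverman AEC IV.2.3, IV.4.3–4.4; `[p](t) ≡ A_p · t^p (mod p, t^{p+1})`)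

Trunk T-NT-EC (Literature/NumberTheory/EllipticCurves). For the chord–tangent formal group law
`F = formalGroupLaw W` of a Weierstrass curve (tree file `FormalGroupLaw.lean`, AEC IV.1) we define
the **formal multiplication-by-`n` series**

* `formalMul W n = [n](t) ∈ R⟦t⟧`, `[0] = 0`, `[n+1](t) = F([n](t), t)` (AEC IV.2, definition before
  Prop. 2.3), over any commutative ring, with `[n](0) = 0`, `[1] = t`, and compatibility with base
  change (`map_formalMul`);

and prove, for a `p`-integral equation `W/ℚ_p` (the setting in which the tree has the formal-group
axioms, `FormalGroupLawAxiomsProofs`, `FormalGroupLawAssocIntegralProofs`):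

* `isPadicInt_formalMul` — `[n] ∈ ℤ_p⟦t⟧`;
* `padicEval_formalMul_formalParameter` — **`[n](z(P)) = z(nP)`** on `E₁(ℚ_p)` (AEC IV.3.2(a) /
  VII.2.2: the formal group computes the group law of `E₁`);
* `formalMul_add`, `formalMul_mul_subst` — `[m+n] = F([m], [n])`, `[m]([n](t)) = [mn](t)`
  (AEC IV.2.3: `[m]` are endomorphisms, `[m] ∘ [n] = [mn]`), by the identity theorem for integral
  power series from the pointwise statements;
* `formalLog_subst_formalMul` — `log([n](t)) = n · log(t)` (AEC IV.5: `log` is a homomorphism);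
* `formalOmega_subst_formalMul_mul_derivative` — **`ω([n](t)) · [n]'(t) = n · ω(t)`**
  (AEC IV.4.3 for `f = [n]`), whence `coeff_one_formalMul`: `[n](t) = n t + O(t²)` (AEC IV.2.3(a));
* `norm_coeff_formalMul_prime_le` — **AEC IV.4.4: `[p](t) = p f(t) + g(t^p)`**, in the form
  `‖[t^k][p]‖ ≤ ‖p‖` for every `k` not divisible by `p`;
* `norm_coeff_prime_formalMul_sub_coeff_formalOmega_le` — `[t^p][p] ≡ c_{p-1} (mod p)` where
  `ω = Σ cₙ tⁿ dt`, and, for `p` odd, with the tree's `coeff_formalInvDiff_prime_sub_one`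
  (`c_{p-1} ≡ A_p`, Deuring–Hasse, `FormalGroupHasseInvariantProofs`),
  **`norm_coeff_prime_formalMul_sub_hasseCoeff_lt_one`: `[p](t) ≡ A_p(W) · t^p (mod p, t^{p+1})`**
  — the Hasse invariant is the first coefficient of `[p]` modulo `p` (Katz–Mazur 12.4; Silverman AEC
  IV.7 with V.4.1(a));
* `formalMul_prime_eq_add_subst_X_pow` — AEC IV.4.4 as printed, **`[p](t) = p·f(t) + g(t^p)`** with
  the explicit integral series `f = formalMulPRemPart`, `g = formalMulPDivPart`
  (`isPadicInt_formalMulPRemPart`, `isPadicInt_formalMulPDivPart`), `g(s) ≡ A_p s (mod p, s²)`.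

Everything is PROVED (no named fact); the only new data are the definitions `formalMul`,
`formalMulPDivPart`, `formalMulPRemPart`.

## References

* J. H. Silverman, *The Arithmetic of Elliptic Curves*, 2nd ed., GTM 106 (2009): IV.2 (definition
  of `[m]`, Prop. 2.3), IV.3.2, IV.4 (Cor. 4.3, Cor. 4.4), IV.5, IV.7, V.4.1(a), VII.2.2.
  [SilvermanAEC2009]
* N. M. Katz, B. Mazur, *Arithmetic Moduli of Elliptic Curves*, Ann. of Math. Stud. 108 (1985),
  §12.4 (the Hasse invariant as the coefficient of `t^p` in `[p](t)`).
* C. Blakestad, D. Grant, *The universal `p`-adic sigma and Weierstrass zeta functions*,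
  arXiv:1903.02480, Prop. 3 and Remark (lifts of the Hasse invariant). [BlakestadGrant2023]

## Design notes

* `[n+1] = F([n], t)` (AEC's order `F([m]T, T)`), so that `[1] = F(0, t) = t` is the tree's
  `formalGroupLaw_subst_zero_X` over any ring.
* Over `ℚ_p` the identities are obtained from the group `E₁(ℚ_p)`: every `z` with `‖z‖ < 1` is
  `z(P)` for some `P ∈ E₁(ℚ_p)` (`exists_isInReductionKernel_formalParameter_eq_of_isIntegral`),
  `F(z(P), z(Q)) = z(P + Q)` (`padicEval₂_formalGroupLaw_eq_formalParameter_add`), and two integral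
  series agreeing on the open unit disc are equal (`eq_of_padicEval_eq`).
* `ω([n])·[n]' = nω` is the derivative (`PowerSeries.derivative_subst`) of `log ∘ [n] = n log`,
  itself the specialisation `z₁ ↦ [n](t), z₂ ↦ t` of `log F(z₁, z₂) = log z₁ + log z₂`
  (`formalLog_subst_formalGroupLaw_of_assoc` with `formalGroupLaw_assoc_of_isIntegral`).
* AEC IV.4.4 and the Hasse congruence are read off coefficientwise from `ω([p])·[p]' = pω` with
  `p`-adic norms (`‖·‖ ≤ ‖p‖` in place of "`≡ 0 mod p`").
-/

noncomputable section

open scoped Classical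
open PowerSeries Literature.NumberTheory.EllipticCurves

namespace WeierstrassCurve

/-! ### The series `[n](t)` over any ring -/

section General

variable {R : Type*} [CommRing R] (W : WeierstrassCurve R)

/-- **The formal multiplication-by-`n` map** `[n](t) ∈ R⟦t⟧` of the formal group `Ê` of `W`:
`[0](t) = 0`, `[n+1](t) = F([n](t), t)` with `F = formalGroupLaw W` the chord–tangent law.
[Silverman AEC IV.2 (definition of `[m]` before Prop. 2.3: "`[0](T) = 0,
[m+1](T) = F([m](T), T)`")] [cite: SilvermanAEC2009, IV.2.3] -/
def formalMul (W : WeierstrassCurve R) : ℕ → R⟦X⟧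
  | 0 => 0
  | n + 1 => MvPowerSeries.subst ![formalMul W n, (X : R⟦X⟧)] W.formalGroupLaw

/-- `[0] = 0`. [Silverman AEC IV.2] [folklore] -/
@[simp] theorem formalMul_zero : W.formalMul 0 = 0 := rfl

/-- `[n+1](t) = F([n](t), t)`. [Silverman AEC IV.2] [folklore] -/
theorem formalMul_succ (n : ℕ) :
    W.formalMul (n + 1) = MvPowerSeries.subst ![W.formalMul n, (X : R⟦X⟧)] W.formalGroupLaw := rfl

/-- The substitution `z₁ ↦ f`, `z₂ ↦ t` is admissible when `f(0) = 0`. [folklore] -/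
theorem _root_.Literature.NumberTheory.EllipticCurves.hasSubst_pair_X {f : R⟦X⟧}
    (hf : constantCoeff f = 0) : MvPowerSeries.HasSubst ![f, (X : R⟦X⟧)] :=
  MvPowerSeries.hasSubst_of_constantCoeff_zero fun i => by
    fin_cases i
    · exact hf
    · exact constantCoeff_X

/-- `[n](0) = 0`. [Silverman AEC IV.2.3(a)] [folklore] -/
@[simp] theorem constantCoeff_formalMul (n : ℕ) : constantCoeff (W.formalMul n) = 0 := by
  induction n with
  | zero => simp
  | succ n ih =>
    rw [formalMul_succ]
    exact MvPowerSeries.constantCoeff_subst_eq_zero (hasSubst_pair_X ih)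
      (fun i => by
        fin_cases i
        · exact ih
        · exact constantCoeff_X) W.constantCoeff_formalGroupLaw

/-- The substitution defining `[n+1]` is admissible. [folklore] -/
theorem hasSubst_formalMul_pair (n : ℕ) :
    MvPowerSeries.HasSubst ![W.formalMul n, (X : R⟦X⟧)] :=
  hasSubst_pair_X (W.constantCoeff_formalMul n)

/-- `[n]` is substitutable (no constant term). [folklore] -/
theorem hasSubst_formalMul (n : ℕ) : HasSubst (W.formalMul n) :=
  HasSubst.of_constantCoeff_zero' (W.constantCoeff_formalMul n)

/-- **`[1](t) = t`** (`= F(0, t)`). [Silverman AEC IV.2 Def. (e), IV.2.3] [folklore] -/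
@[simp] theorem formalMul_one : W.formalMul 1 = X := by
  rw [formalMul_succ, formalMul_zero]
  exact W.formalGroupLaw_subst_zero_X

/-- `[2](t) = F(t, t)`. [Silverman AEC IV.2] [folklore] -/
theorem formalMul_two :
    W.formalMul 2 = MvPowerSeries.subst ![(X : R⟦X⟧), X] W.formalGroupLaw := by
  rw [formalMul_succ, formalMul_one]

/-- **`[n]` commutes with base change** (its coefficients lie in `ℤ[a₁, …, a₆]`).
[Silverman AEC IV.2.3(a) (`[m] ∈ R⟦T⟧`), IV.1] [folklore] -/
theorem map_formalMul {S : Type*} [CommRing S] (φ : R →+* S) (n : ℕ) :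
    PowerSeries.map φ (W.formalMul n) = (W.map φ).formalMul n := by
  induction n with
  | zero => simp
  | succ n ih =>
    rw [formalMul_succ, formalMul_succ]
    change MvPowerSeries.map φ (MvPowerSeries.subst ![W.formalMul n, X] W.formalGroupLaw) = _
    rw [MvPowerSeries.map_subst (W.hasSubst_formalMul_pair n), W.map_formalGroupLaw φ]
    congr 1
    funext i
    fin_cases i
    · exact ih
    · show PowerSeries.map φ (X : R⟦X⟧) = X
      exact PowerSeries.map_X φ

end General

/-! ### Over `ℚ_p`: integrality and the values `[n](z(P)) = z(nP)` -/

section Padic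

variable {p : ℕ} [Fact p.Prime] (W : WeierstrassCurve ℚ_[p]) [hW : W.IsIntegral ℤ_[p]]

/-- **`[n] ∈ ℤ_p⟦t⟧`** for a `p`-integral equation. [Silverman AEC IV.2.3(a), VII.2.2] [folklore] -/
theorem isPadicInt_formalMul (n : ℕ) : IsPadicInt (W.formalMul n) := by
  induction n with
  | zero => exact IsPadicInt.zero
  | succ n ih =>
    rw [formalMul_succ]
    exact W.isPadicInt_formalGroupLaw.subst (fun i => by
      fin_cases i
      · exact ih
      · exact IsPadicInt.powerSeries_X) (W.hasSubst_formalMul_pair n)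

/-- The values of `F(f(t), t)` at `‖t‖ < 1`: `F(f, X)(t) = F(f(t), t)`. [folklore] -/
theorem padicEval_subst_pair_X {f : ℚ_[p]⟦X⟧} (hf : IsPadicInt f) (hf0 : constantCoeff f = 0)
    {F : MvPowerSeries (Fin 2) ℚ_[p]} (hF : IsPadicInt F) {t : ℚ_[p]} (ht : ‖t‖ < 1) :
    padicEval (MvPowerSeries.subst ![f, (X : ℚ_[p]⟦X⟧)] F) t = padicEval₂ F (padicEval f t) t := by
  have ha : ∀ i, IsPadicInt ((![f, (X : ℚ_[p]⟦X⟧)]) i) := fun i => by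
    fin_cases i
    · exact hf
    · exact IsPadicInt.powerSeries_X
  have ha0 : ∀ i, MvPowerSeries.constantCoeff ((![f, (X : ℚ_[p]⟦X⟧)]) i) = 0 := fun i => by
    fin_cases i
    · exact hf0
    · exact constantCoeff_X
  rw [padicEval_eq_padicEvalMv, padicEvalMv_subst hF ha ha0 (fun _ => ht)]
  have hpt : (fun i => padicEvalMv ((![f, (X : ℚ_[p]⟦X⟧)]) i) fun _ : Unit => t) =
      ![padicEval f t, t] := by
    funext i
    fin_cases i
    · show padicEvalMv f (fun _ : Unit => t) = padicEval f t
      rw [← padicEval_eq_padicEvalMv]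
    · show padicEvalMv (X : ℚ_[p]⟦X⟧) (fun _ : Unit => t) = t
      rw [← padicEval_eq_padicEvalMv, padicEval_X]
  rw [hpt, ← padicEval₂_eq_padicEvalMv]

/-- The values of `F(f(t), g(t))` at `‖t‖ < 1`. [folklore] -/
theorem padicEval_subst_pair {f g : ℚ_[p]⟦X⟧} (hf : IsPadicInt f) (hf0 : constantCoeff f = 0)
    (hg : IsPadicInt g) (hg0 : constantCoeff g = 0) {F : MvPowerSeries (Fin 2) ℚ_[p]}
    (hF : IsPadicInt F) {t : ℚ_[p]} (ht : ‖t‖ < 1) :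
    padicEval (MvPowerSeries.subst ![f, g] F) t = padicEval₂ F (padicEval f t) (padicEval g t) := by
  have ha : ∀ i, IsPadicInt ((![f, g]) i) := fun i => by
    fin_cases i
    · exact hf
    · exact hg
  have ha0 : ∀ i, MvPowerSeries.constantCoeff ((![f, g]) i) = 0 := fun i => by
    fin_cases i
    · exact hf0
    · exact hg0
  rw [padicEval_eq_padicEvalMv, padicEvalMv_subst hF ha ha0 (fun _ => ht)]
  have hpt : (fun i => padicEvalMv ((![f, g]) i) fun _ : Unit => t) =
      ![padicEval f t, padicEval g t] := by
    funext i
    fin_cases i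
    · show padicEvalMv f (fun _ : Unit => t) = padicEval f t
      rw [← padicEval_eq_padicEvalMv]
    · show padicEvalMv g (fun _ : Unit => t) = padicEval g t
      rw [← padicEval_eq_padicEvalMv]
  rw [hpt, ← padicEval₂_eq_padicEvalMv]

/-- `0(t) = 0`. [folklore] -/
theorem _root_.Literature.NumberTheory.EllipticCurves.padicEval_zero_left (t : ℚ_[p]) :
    padicEval (0 : ℚ_[p]⟦X⟧) t = 0 := by
  rw [← map_zero (PowerSeries.C (R := ℚ_[p])), padicEval_C]

/-- **`[n](z(P)) = z(nP)` on `E₁(ℚ_p)`**: the formal multiplication computes multiples in the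
kernel of reduction. [Silverman AEC IV.3.2(a), VII.2.2 (`E₁(K) ≅ Ê(𝓜)`)]
[cite: SilvermanAEC2009, VII.2.2] -/
theorem padicEval_formalMul_formalParameter (n : ℕ) {P : W.toAffine.Point}
    (hP : W.IsInReductionKernel P) :
    padicEval (W.formalMul n) (W.formalParameter P) = W.formalParameter (n • P) := by
  induction n with
  | zero => rw [formalMul_zero, zero_nsmul, formalParameter_zero, padicEval_zero_left]
  | succ n ih =>
    rw [formalMul_succ, padicEval_subst_pair_X (W.isPadicInt_formalMul n) (W.constantCoeff_formalMul n)
      W.isPadicInt_formalGroupLaw (W.norm_formalParameter_lt_one hP), ih,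
      W.padicEval₂_formalGroupLaw_eq_formalParameter_add (W.isInReductionKernel_nsmul hP n) hP,
      succ_nsmul]

/-- **`[m + n](t) = F([m](t), [n](t))`**: `n ↦ [n]` is additive for the formal group law (the maps
`[m]` are endomorphisms of `Ê`). [Silverman AEC IV.2.3 (proof: "`[m]` is a homomorphism by an easy
induction")] [cite: SilvermanAEC2009, IV.2.3] -/
theorem formalMul_add (m n : ℕ) :
    W.formalMul (m + n) = MvPowerSeries.subst ![W.formalMul m, W.formalMul n] W.formalGroupLaw := by
  have hs : MvPowerSeries.HasSubst ![W.formalMul m, W.formalMul n] :=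
    MvPowerSeries.hasSubst_of_constantCoeff_zero fun i => by
      fin_cases i <;> exact W.constantCoeff_formalMul _
  have hint : IsPadicInt (MvPowerSeries.subst ![W.formalMul m, W.formalMul n] W.formalGroupLaw) :=
    W.isPadicInt_formalGroupLaw.subst (fun i => by
      fin_cases i <;> exact W.isPadicInt_formalMul _) hs
  refine eq_of_padicEval_eq (W.isPadicInt_formalMul _) hint fun t ht => ?_
  obtain ⟨P, hP, rfl⟩ := W.exists_isInReductionKernel_formalParameter_eq_of_isIntegral ht
  rw [padicEval_subst_pair (W.isPadicInt_formalMul m) (W.constantCoeff_formalMul m)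
      (W.isPadicInt_formalMul n) (W.constantCoeff_formalMul n) W.isPadicInt_formalGroupLaw ht,
    W.padicEval_formalMul_formalParameter _ hP, W.padicEval_formalMul_formalParameter _ hP,
    W.padicEval_formalMul_formalParameter _ hP,
    W.padicEval₂_formalGroupLaw_eq_formalParameter_add (W.isInReductionKernel_nsmul hP m)
      (W.isInReductionKernel_nsmul hP n), add_nsmul]

/-- **`[m]([n](t)) = [mn](t)`**. [Silverman AEC IV.2.3 (`[m] ∘ [n] = [mn]`)]
[cite: SilvermanAEC2009, IV.2.3] -/
theorem formalMul_mul_subst (m n : ℕ) :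
    (W.formalMul m).subst (W.formalMul n) = W.formalMul (m * n) := by
  have hint : IsPadicInt ((W.formalMul m).subst (W.formalMul n)) :=
    (W.isPadicInt_formalMul m).powerSeries_subst (W.isPadicInt_formalMul n) (W.hasSubst_formalMul n)
  refine eq_of_padicEval_eq hint (W.isPadicInt_formalMul _) fun t ht => ?_
  obtain ⟨P, hP, rfl⟩ := W.exists_isInReductionKernel_formalParameter_eq_of_isIntegral ht
  rw [padicEval_subst (W.isPadicInt_formalMul m) (W.isPadicInt_formalMul n)
      (W.constantCoeff_formalMul n) ht,
    W.padicEval_formalMul_formalParameter _ hP,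
    W.padicEval_formalMul_formalParameter _ (W.isInReductionKernel_nsmul hP n),
    W.padicEval_formalMul_formalParameter _ hP, mul_comm m n, mul_nsmul]

/-- `[m] ∘ [n] = [n] ∘ [m]`. [Silverman AEC IV.2.3] [folklore] -/
theorem formalMul_subst_comm (m n : ℕ) :
    (W.formalMul m).subst (W.formalMul n) = (W.formalMul n).subst (W.formalMul m) := by
  rw [formalMul_mul_subst, formalMul_mul_subst, mul_comm]

/-- `F([n](t), t) = F(t, [n](t))` (both are `[n+1](t)`). [Silverman AEC IV.2.1(c)] [folklore] -/
theorem formalMul_succ' (n : ℕ) :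
    W.formalMul (n + 1) = MvPowerSeries.subst ![(X : ℚ_[p]⟦X⟧), W.formalMul n] W.formalGroupLaw := by
  rw [add_comm, formalMul_add, formalMul_one]

end Padic

/-! ### `log ∘ [n] = n · log` and `ω([n]) · [n]' = n · ω` -/

section LogDeriv

variable {p : ℕ} [Fact p.Prime] (W : WeierstrassCurve ℚ_[p]) [hW : W.IsIntegral ℤ_[p]]

/-- **`log([n](t)) = n · log(t)`**: the formal logarithm is a homomorphism `Ê → 𝔾̂ₐ`, so it
linearises the multiplication maps (specialise `log F(z₁, z₂) = log z₁ + log z₂` at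
`z₁ = [n](t)`, `z₂ = t`). [Silverman AEC IV.5.2 with IV.2.3] [cite: SilvermanAEC2009, IV.5.2] -/
theorem formalLog_subst_formalMul (n : ℕ) :
    W.formalLog.subst (W.formalMul n) = n • W.formalLog := by
  induction n with
  | zero =>
    rw [formalMul_zero, zero_nsmul]
    exact subst_zero_of_constantCoeff_zero W.constantCoeff_formalLog
  | succ n ih =>
    have hs := W.hasSubst_formalMul_pair n
    have key := congrArg (MvPowerSeries.subst ![W.formalMul n, (X : ℚ_[p]⟦X⟧)])
      (W.formalLog_subst_formalGroupLaw_of_assoc W.formalGroupLaw_assoc_of_isIntegral)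
    rw [mvSubst_powerSeries_subst W.hasSubst_formalGroupLaw hs, MvPowerSeries.subst_add hs,
      mvSubst_powerSeries_subst (HasSubst.X 0) hs, mvSubst_powerSeries_subst (HasSubst.X 1) hs,
      MvPowerSeries.subst_X hs 0, MvPowerSeries.subst_X hs 1] at key
    rw [formalMul_succ, key, succ_nsmul, ← ih]
    show W.formalLog.subst (W.formalMul n) + W.formalLog.subst (X : ℚ_[p]⟦X⟧) = _
    rw [X_subst]

/-- **`ω([n](t)) · [n]'(t) = n · ω(t)`** (`ω = formalOmega = d log/dt`): Silverman's Cor. IV.4.3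
(`ω_G(f(T)) · f'(T) = f'(0) · ω_F(T)` for a homomorphism `f`) for `f = [n] : Ê → Ê`, obtained by
differentiating `log ∘ [n] = n · log`. [Silverman AEC IV.4.3, IV.2.3]
[cite: SilvermanAEC2009, IV.4.3] -/
theorem formalOmega_subst_formalMul_mul_derivative (n : ℕ) :
    W.formalOmega.subst (W.formalMul n) * d⁄dX ℚ_[p] (W.formalMul n) = n • W.formalOmega := by
  have h := congrArg (d⁄dX ℚ_[p]) (W.formalLog_subst_formalMul n)
  rwa [derivative_subst ℚ_[p] (W.hasSubst_formalMul n), map_nsmul, W.derivative_formalLog] at h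

/-- **`[n](t) = n t + O(t²)`.** [Silverman AEC IV.2.3(a)] [cite: SilvermanAEC2009, IV.2.3] -/
theorem coeff_one_formalMul (n : ℕ) : coeff 1 (W.formalMul n) = n := by
  have h := congrArg constantCoeff (W.formalOmega_subst_formalMul_mul_derivative n)
  rw [map_mul, constantCoeff_subst_of_constantCoeff_eq_zero (W.constantCoeff_formalMul n),
    W.constantCoeff_formalOmega, one_mul, map_nsmul, W.constantCoeff_formalOmega,
    ← coeff_zero_eq_constantCoeff_apply, coeff_derivative, zero_add, Nat.cast_zero, zero_add,
    mul_one, nsmul_eq_mul, mul_one] at h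
  exact h

/-- `ω([n](t)) ∈ ℤ_p⟦t⟧`. [folklore] -/
theorem isPadicInt_formalOmega_subst_formalMul (n : ℕ) :
    IsPadicInt (W.formalOmega.subst (W.formalMul n)) :=
  W.isPadicInt_formalOmega.powerSeries_subst (W.isPadicInt_formalMul n) (W.hasSubst_formalMul n)

omit hW in
/-- `ω([n](0)) = ω(0) = 1`. [folklore] -/
theorem coeff_zero_formalOmega_subst_formalMul (n : ℕ) :
    coeff 0 (W.formalOmega.subst (W.formalMul n)) = 1 := by
  rw [coeff_zero_eq_constantCoeff_apply,
    constantCoeff_subst_of_constantCoeff_eq_zero (W.constantCoeff_formalMul n),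
    W.constantCoeff_formalOmega]

end LogDeriv

/-! ### `[p](t) = p f(t) + g(t^p)` and `[p](t) ≡ A_p t^p (mod p, t^{p+1})` -/

section PrimeMul

variable {p : ℕ} [Fact p.Prime] (W : WeierstrassCurve ℚ_[p]) [hW : W.IsIntegral ℤ_[p]]

/-- `‖n‖_p ≤ ‖p‖_p` when `p ∣ n` (and `‖n‖_p ≤ 1` always, `Padic.norm_int_le_one`; cf. the tree's
`norm_natCast_le_one` in `PAdicHeightsLogProofs`). [folklore] -/
theorem _root_.Literature.NumberTheory.EllipticCurves.padic_norm_natCast_le_norm_p_of_dvd {n : ℕ}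
    (h : p ∣ n) : ‖(n : ℚ_[p])‖ ≤ ‖(p : ℚ_[p])‖ := by
  obtain ⟨c, rfl⟩ := h
  rw [Nat.cast_mul, norm_mul]
  exact mul_le_of_le_one_right (norm_nonneg _) (by simpa using Padic.norm_int_le_one (p := p) (c : ℤ))

/-- `‖a - b‖ ≤ max ‖a‖ ‖b‖` in `ℚ_p`. [folklore] -/
theorem _root_.Literature.NumberTheory.EllipticCurves.padic_norm_sub_le_max (a b : ℚ_[p]) :
    ‖a - b‖ ≤ max ‖a‖ ‖b‖ := by
  simpa [sub_eq_add_neg, norm_neg] using IsUltrametricDist.norm_add_le_max a (-b)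

/-- **Silverman AEC IV.4.4: `[p](t) = p f(t) + g(t^p)` with `f, g ∈ ℤ_p⟦t⟧`** — every
coefficient of `[p](t)` in a degree NOT divisible by `p` is divisible by `p`:
`‖[t^k][p]‖_p ≤ ‖p‖_p = p⁻¹` for `p ∤ k`. Proof as printed: compare coefficients of `t^{k-1}` in
`ω([p](t))·[p]'(t) = p·ω(t)` (Cor. IV.4.3); by induction the other terms are `≡ 0 (mod p)`, so
`k·[t^k][p] ≡ 0`, and `k` is a `p`-adic unit. [Silverman AEC IV.4.4]
[cite: SilvermanAEC2009, IV.4.4] -/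
theorem norm_coeff_formalMul_prime_le {k : ℕ} (hk : ¬ p ∣ k) :
    ‖coeff k (W.formalMul p)‖ ≤ ‖(p : ℚ_[p])‖ := by
  have hp : p.Prime := Fact.out
  induction k using Nat.strong_induction_on with
  | _ k ih =>
  obtain ⟨k', rfl⟩ : ∃ k', k = k' + 1 :=
    Nat.exists_eq_succ_of_ne_zero (by rintro rfl; exact hk (dvd_zero p))
  set E := W.formalOmega.subst (W.formalMul p) with hE
  set D := d⁄dX ℚ_[p] (W.formalMul p) with hD
  have hid := congrArg (coeff k') (W.formalOmega_subst_formalMul_mul_derivative p)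
  rw [coeff_mul, map_nsmul] at hid
  have hmem : ((0, k') : ℕ × ℕ) ∈ Finset.antidiagonal k' := by simp
  rw [← Finset.add_sum_erase _ _ hmem] at hid
  have hmain : coeff ((0, k') : ℕ × ℕ).1 E * coeff ((0, k') : ℕ × ℕ).2 D =
      coeff (k' + 1) (W.formalMul p) * ((k' : ℚ_[p]) + 1) := by
    show coeff 0 E * coeff k' D = _
    rw [hE, W.coeff_zero_formalOmega_subst_formalMul, one_mul, hD, coeff_derivative]
  -- every other term is `≡ 0 (mod p)`
  have hrest : ∀ x ∈ (Finset.antidiagonal k').erase (0, k'),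
      ‖coeff x.1 E * coeff x.2 D‖ ≤ ‖(p : ℚ_[p])‖ := by
    intro x hx
    obtain ⟨hne, hx'⟩ := Finset.mem_erase.mp hx
    rw [Finset.mem_antidiagonal] at hx'
    obtain ⟨a, b⟩ := x
    simp only at hx' hne ⊢
    have hb : b + 1 < k' + 1 := by
      by_contra h
      have hb' : b = k' := by omega
      have ha' : a = 0 := by omega
      exact hne (by rw [ha', hb'])
    have h1 : ‖coeff a E‖ ≤ 1 := isPadicInt_iff_coeff.mp (W.isPadicInt_formalOmega_subst_formalMul p) a
    have h2 : ‖coeff b D‖ ≤ ‖(p : ℚ_[p])‖ := by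
      rw [hD, coeff_derivative, norm_mul,
        show ((b : ℚ_[p]) + 1) = ((b + 1 : ℕ) : ℚ_[p]) by push_cast; rfl]
      by_cases hdvd : p ∣ b + 1
      · calc ‖coeff (b + 1) (W.formalMul p)‖ * ‖((b + 1 : ℕ) : ℚ_[p])‖
            ≤ 1 * ‖(p : ℚ_[p])‖ :=
              mul_le_mul (isPadicInt_iff_coeff.mp (W.isPadicInt_formalMul p) _)
                (padic_norm_natCast_le_norm_p_of_dvd hdvd) (norm_nonneg _) zero_le_one
          _ = ‖(p : ℚ_[p])‖ := one_mul _
      · calc ‖coeff (b + 1) (W.formalMul p)‖ * ‖((b + 1 : ℕ) : ℚ_[p])‖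
            ≤ ‖(p : ℚ_[p])‖ * 1 :=
              mul_le_mul (ih _ hb hdvd) (by simpa using Padic.norm_int_le_one (p := p) ((b + 1 : ℕ) : ℤ)) (norm_nonneg _)
                (norm_nonneg _)
          _ = ‖(p : ℚ_[p])‖ := mul_one _
    calc ‖coeff a E * coeff b D‖ = ‖coeff a E‖ * ‖coeff b D‖ := norm_mul _ _
      _ ≤ 1 * ‖(p : ℚ_[p])‖ := mul_le_mul h1 h2 (norm_nonneg _) zero_le_one
      _ = ‖(p : ℚ_[p])‖ := one_mul _
  have hsum : ‖∑ x ∈ (Finset.antidiagonal k').erase (0, k'), coeff x.1 E * coeff x.2 D‖ ≤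
      ‖(p : ℚ_[p])‖ :=
    IsUltrametricDist.norm_sum_le_of_forall_le_of_nonneg (norm_nonneg _) hrest
  have hrhs : ‖p • coeff k' W.formalOmega‖ ≤ ‖(p : ℚ_[p])‖ := by
    rw [nsmul_eq_mul, norm_mul]
    exact mul_le_of_le_one_right (norm_nonneg _)
      (isPadicInt_iff_coeff.mp W.isPadicInt_formalOmega _)
  have hkey : coeff (k' + 1) (W.formalMul p) * ((k' : ℚ_[p]) + 1) =
      p • coeff k' W.formalOmega -
        ∑ x ∈ (Finset.antidiagonal k').erase (0, k'), coeff x.1 E * coeff x.2 D := by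
    rw [← hid, hmain]; ring
  have hnorm : ‖coeff (k' + 1) (W.formalMul p) * ((k' : ℚ_[p]) + 1)‖ ≤ ‖(p : ℚ_[p])‖ := by
    rw [hkey]
    exact (padic_norm_sub_le_max _ _).trans (max_le hrhs hsum)
  have hk1 : ‖((k' : ℚ_[p]) + 1)‖ = 1 := by
    rw [show ((k' : ℚ_[p]) + 1) = ((k' + 1 : ℕ) : ℚ_[p]) by push_cast; rfl]
    exact Padic.norm_natCast_eq_one_iff.mpr ((Nat.Prime.coprime_iff_not_dvd hp).mpr hk)
  rwa [norm_mul, hk1, mul_one] at hnorm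

/-- In particular **`[p](t) ≡ 0 (mod p, t^p)`**: `‖[t^k][p]‖ ≤ ‖p‖` for all `k < p`.
[Silverman AEC IV.4.4, IV.7.1] [cite: SilvermanAEC2009, IV.4.4] -/
theorem norm_coeff_formalMul_prime_le_of_lt {k : ℕ} (hk : k < p) :
    ‖coeff k (W.formalMul p)‖ ≤ ‖(p : ℚ_[p])‖ := by
  by_cases hk0 : k = 0
  · rw [hk0, coeff_zero_eq_constantCoeff_apply, W.constantCoeff_formalMul, norm_zero]
    exact norm_nonneg _
  · exact W.norm_coeff_formalMul_prime_le fun h =>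
      absurd (Nat.le_of_dvd (Nat.pos_of_ne_zero hk0) h) (not_le.mpr hk)

/-- **`ω([p](t)) ≡ 1 (mod p, t^p)`**: for `0 < i < p` the coefficient of `t^i` in `ω([p](t))` is
divisible by `p` (because `[p](t) ≡ 0 (mod p, t^p)` and `ω(s) - 1 ∈ sℤ_p⟦s⟧`). [Silverman AEC
IV.4.4 (proof), IV.7] [folklore] -/
theorem norm_coeff_formalOmega_subst_formalMul_prime_le {i : ℕ} (hi0 : i ≠ 0) (hi : i < p) :
    ‖coeff i (W.formalOmega.subst (W.formalMul p))‖ ≤ ‖(p : ℚ_[p])‖ := by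
  have hs := W.hasSubst_formalMul p
  set ω₁ : ℚ_[p]⟦X⟧ := PowerSeries.mk fun n => coeff (n + 1) W.formalOmega with hω₁
  have hω : W.formalOmega = X * ω₁ + C (constantCoeff W.formalOmega) :=
    eq_X_mul_shift_add_const _
  have hω₁int : IsPadicInt ω₁ := isPadicInt_iff_coeff.mpr fun n => by
    rw [hω₁, coeff_mk]
    exact isPadicInt_iff_coeff.mp W.isPadicInt_formalOmega _
  have hsub : W.formalOmega.subst (W.formalMul p) =
      W.formalMul p * ω₁.subst (W.formalMul p) + C (constantCoeff W.formalOmega) := by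
    conv_lhs => rw [hω]
    rw [← coe_substAlgHom hs, map_add, map_mul, coe_substAlgHom, subst_X hs, subst_C]
    rfl
  rw [hsub, map_add, coeff_C, if_neg hi0, add_zero, coeff_mul]
  refine IsUltrametricDist.norm_sum_le_of_forall_le_of_nonneg (norm_nonneg _) fun x hx => ?_
  rw [Finset.mem_antidiagonal] at hx
  have h2 : ‖coeff x.2 (ω₁.subst (W.formalMul p))‖ ≤ 1 :=
    isPadicInt_iff_coeff.mp (hω₁int.powerSeries_subst (W.isPadicInt_formalMul p) hs) _
  have h1 : ‖coeff x.1 (W.formalMul p)‖ ≤ ‖(p : ℚ_[p])‖ :=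
    W.norm_coeff_formalMul_prime_le_of_lt (by omega)
  calc ‖coeff x.1 (W.formalMul p) * coeff x.2 (ω₁.subst (W.formalMul p))‖
      = ‖coeff x.1 (W.formalMul p)‖ * ‖coeff x.2 (ω₁.subst (W.formalMul p))‖ := norm_mul _ _
    _ ≤ ‖(p : ℚ_[p])‖ * 1 := mul_le_mul h1 h2 (norm_nonneg _) (norm_nonneg _)
    _ = ‖(p : ℚ_[p])‖ := mul_one _

/-- **`[t^p][p] ≡ c_{p-1} (mod p)`**, where `ω = Σ cₙ tⁿ dt`: compare coefficients of `t^{p-1}` in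
`ω([p])·[p]' = p·ω` modulo `p²` (the cross terms are `≡ 0 (mod p²)` by IV.4.4 and
`ω([p]) ≡ 1 (mod p, t^p)`). [Silverman AEC IV.4.4, IV.7 (height `≥ 1`); Katz–Mazur 12.4]
[folklore] -/
theorem norm_coeff_prime_formalMul_sub_coeff_formalOmega_le :
    ‖coeff p (W.formalMul p) - coeff (p - 1) W.formalOmega‖ ≤ ‖(p : ℚ_[p])‖ := by
  have hp : p.Prime := Fact.out
  have hp1 : p - 1 + 1 = p := Nat.sub_add_cancel hp.one_le
  set E := W.formalOmega.subst (W.formalMul p) with hE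
  set D := d⁄dX ℚ_[p] (W.formalMul p) with hD
  have hid := congrArg (coeff (p - 1)) (W.formalOmega_subst_formalMul_mul_derivative p)
  rw [coeff_mul, map_nsmul] at hid
  have hmem : ((0, p - 1) : ℕ × ℕ) ∈ Finset.antidiagonal (p - 1) := by simp
  rw [← Finset.add_sum_erase _ _ hmem] at hid
  have hcast : ((p - 1 : ℕ) : ℚ_[p]) + 1 = p := by
    rw [← Nat.cast_succ, Nat.succ_eq_add_one, hp1]
  have hmain : coeff ((0, p - 1) : ℕ × ℕ).1 E * coeff ((0, p - 1) : ℕ × ℕ).2 D =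
      (p : ℚ_[p]) * coeff p (W.formalMul p) := by
    show coeff 0 E * coeff (p - 1) D = _
    rw [hE, W.coeff_zero_formalOmega_subst_formalMul, one_mul, hD, coeff_derivative, hp1, hcast,
      mul_comm]
  -- every other term is `≡ 0 (mod p²)`
  have hrest : ∀ x ∈ (Finset.antidiagonal (p - 1)).erase (0, p - 1),
      ‖coeff x.1 E * coeff x.2 D‖ ≤ ‖(p : ℚ_[p])‖ * ‖(p : ℚ_[p])‖ := by
    intro x hx
    obtain ⟨hne, hx'⟩ := Finset.mem_erase.mp hx
    rw [Finset.mem_antidiagonal] at hx'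
    obtain ⟨a, b⟩ := x
    simp only at hx' hne ⊢
    have ha0 : a ≠ 0 := by
      intro ha
      have hb' : b = p - 1 := by omega
      exact hne (by rw [ha, hb'])
    have h1 : ‖coeff a E‖ ≤ ‖(p : ℚ_[p])‖ :=
      W.norm_coeff_formalOmega_subst_formalMul_prime_le ha0 (by omega)
    have h2 : ‖coeff b D‖ ≤ ‖(p : ℚ_[p])‖ := by
      rw [hD, coeff_derivative, norm_mul,
        show ((b : ℚ_[p]) + 1) = ((b + 1 : ℕ) : ℚ_[p]) by push_cast; rfl]
      calc ‖coeff (b + 1) (W.formalMul p)‖ * ‖((b + 1 : ℕ) : ℚ_[p])‖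
          ≤ ‖(p : ℚ_[p])‖ * 1 :=
            mul_le_mul (W.norm_coeff_formalMul_prime_le_of_lt (by omega))
              (by simpa using Padic.norm_int_le_one (p := p) ((b + 1 : ℕ) : ℤ)) (norm_nonneg _) (norm_nonneg _)
        _ = ‖(p : ℚ_[p])‖ := mul_one _
    calc ‖coeff a E * coeff b D‖ = ‖coeff a E‖ * ‖coeff b D‖ := norm_mul _ _
      _ ≤ ‖(p : ℚ_[p])‖ * ‖(p : ℚ_[p])‖ := mul_le_mul h1 h2 (norm_nonneg _) (norm_nonneg _)
  have hsum : ‖∑ x ∈ (Finset.antidiagonal (p - 1)).erase (0, p - 1), coeff x.1 E * coeff x.2 D‖ ≤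
      ‖(p : ℚ_[p])‖ * ‖(p : ℚ_[p])‖ :=
    IsUltrametricDist.norm_sum_le_of_forall_le_of_nonneg
      (mul_nonneg (norm_nonneg _) (norm_nonneg _)) hrest
  have hkey : (p : ℚ_[p]) * (coeff p (W.formalMul p) - coeff (p - 1) W.formalOmega) =
      -∑ x ∈ (Finset.antidiagonal (p - 1)).erase (0, p - 1), coeff x.1 E * coeff x.2 D := by
    have : (p : ℚ_[p]) * coeff p (W.formalMul p) +
        ∑ x ∈ (Finset.antidiagonal (p - 1)).erase (0, p - 1), coeff x.1 E * coeff x.2 D =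
        p • coeff (p - 1) W.formalOmega := by rw [← hid, hmain]
    rw [nsmul_eq_mul] at this
    linear_combination this
  have hp0 : 0 < ‖(p : ℚ_[p])‖ := norm_pos_iff.mpr (Nat.cast_ne_zero.mpr hp.ne_zero)
  have hnorm : ‖(p : ℚ_[p])‖ * ‖coeff p (W.formalMul p) - coeff (p - 1) W.formalOmega‖ ≤
      ‖(p : ℚ_[p])‖ * ‖(p : ℚ_[p])‖ := by
    rw [← norm_mul, hkey, norm_neg]; exact hsum
  exact le_of_mul_le_mul_left hnorm hp0

/-- **Deuring–Hasse, `p`-adically: `c_{p-1} ≡ A_p(W) (mod p)`** for a `p`-integral equation over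
`ℚ_p`, `p` odd (`ω = Σ cₙ tⁿ dt`, `A_p = hasseCoeff`, the coefficient of `x^{p-1}` in
`(4x³ + b₂x² + 2b₄x + b₆)^{(p-1)/2}`): the reduction of the tree's characteristic-`p` identity
`coeff_formalInvDiff_prime_sub_one` along `ℤ_p → 𝔽_p`. [Silverman AEC V.4.1(a); Blakestad–Grant
2023, Remark after Prop. 3 (`H₁ = w_{p-1}`)] [cite: BlakestadGrant2023, Prop. 3] -/
theorem norm_coeff_formalOmega_sub_hasseCoeff_lt_one (hp2 : p ≠ 2) :
    ‖coeff (p - 1) W.formalOmega - W.hasseCoeff p‖ < 1 := by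
  have hp : p.Prime := Fact.out
  obtain ⟨m, hpm⟩ : ∃ m, p = 2 * m + 1 := hp.eq_two_or_odd'.resolve_left hp2
  set V := W.integralModel ℤ_[p] with hV
  have hVW : V.map PadicInt.Coe.ringHom = W := W.eq_map_integralModel
  have h1 : coeff (p - 1) W.formalOmega = ((coeff (p - 1) V.formalInvDiff : ℤ_[p]) : ℚ_[p]) := by
    rw [← W.formalInvDiff_eq_formalOmega, ← hVW, ← map_formalInvDiff, coeff_map]; rfl
  have h2 : W.hasseCoeff p = ((V.hasseCoeff p : ℤ_[p]) : ℚ_[p]) := by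
    rw [← hVW, map_hasseCoeff]; rfl
  rw [h1, h2, ← PadicInt.coe_sub, PadicInt.padic_norm_e_of_padicInt, PadicInt.norm_lt_one_iff_dvd,
    ← Ideal.mem_span_singleton, ← PadicInt.maximalIdeal_eq_span_p, ← PadicInt.ker_toZMod,
    RingHom.mem_ker, map_sub, sub_eq_zero]
  have h3 : PadicInt.toZMod (coeff (p - 1) V.formalInvDiff) =
      coeff (p - 1) (V.map (PadicInt.toZMod (p := p))).formalInvDiff := by
    rw [← map_formalInvDiff, coeff_map]
  rw [h3, ← map_hasseCoeff]
  exact (V.map (PadicInt.toZMod (p := p))).coeff_formalInvDiff_prime_sub_one p hpm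

/-- **`[p](t) ≡ A_p(W) · t^p (mod p, t^{p+1})`** for a `p`-integral Weierstrass equation over `ℚ_p`,
`p` odd: the Hasse invariant is the first coefficient of the multiplication-by-`p` map of the formal
group (so `Ê mod p` has height `1` iff `A_p ≢ 0`, i.e. iff the reduction is ordinary).
Together with `norm_coeff_formalMul_prime_le_of_lt` (`[p] ≡ 0 (mod p, t^p)`).
[Katz–Mazur 1985, 12.4; Silverman AEC IV.7 (height), V.4.1(a) with V.3.1]
[cite: SilvermanAEC2009, IV.7.1] -/
theorem norm_coeff_prime_formalMul_sub_hasseCoeff_lt_one (hp2 : p ≠ 2) :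
    ‖coeff p (W.formalMul p) - W.hasseCoeff p‖ < 1 :=
  calc ‖coeff p (W.formalMul p) - W.hasseCoeff p‖
      = ‖(coeff p (W.formalMul p) - coeff (p - 1) W.formalOmega) +
          (coeff (p - 1) W.formalOmega - W.hasseCoeff p)‖ := by rw [sub_add_sub_cancel]
    _ ≤ max ‖coeff p (W.formalMul p) - coeff (p - 1) W.formalOmega‖
          ‖coeff (p - 1) W.formalOmega - W.hasseCoeff p‖ := IsUltrametricDist.norm_add_le_max _ _
    _ < 1 := max_lt (W.norm_coeff_prime_formalMul_sub_coeff_formalOmega_le.trans_lt Padic.norm_p_lt_one)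
          (W.norm_coeff_formalOmega_sub_hasseCoeff_lt_one hp2)

end PrimeMul

/-! ### Silverman's form of AEC IV.4.4: `[p](t) = p·f(t) + g(t^p)` with `f, g ∈ ℤ_p⟦t⟧` -/

section Decomposition

variable {p : ℕ} [Fact p.Prime] (W : WeierstrassCurve ℚ_[p]) [hW : W.IsIntegral ℤ_[p]]

/-- **`g`** in `[p](t) = p f(t) + g(t^p)`: the series `g(s) = Σₖ [t^{pk}][p] · sᵏ` collecting the
coefficients of `[p](t)` in degrees divisible by `p` (a lift of the Verschiebung: `[p] ≡ g(t^p)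
(mod p)`). [Silverman AEC IV.4.4] [cite: SilvermanAEC2009, IV.4.4] -/
def formalMulPDivPart (W : WeierstrassCurve ℚ_[p]) : ℚ_[p]⟦X⟧ :=
  PowerSeries.mk fun k => coeff (p * k) (W.formalMul p)

/-- **`f`** in `[p](t) = p f(t) + g(t^p)`: `f(t) = Σ_{p ∤ k} ([t^k][p] / p) · tᵏ`.
[Silverman AEC IV.4.4] [cite: SilvermanAEC2009, IV.4.4] -/
def formalMulPRemPart (W : WeierstrassCurve ℚ_[p]) : ℚ_[p]⟦X⟧ :=
  PowerSeries.mk fun k => if p ∣ k then 0 else (p : ℚ_[p])⁻¹ * coeff k (W.formalMul p)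

omit hW in
/-- **AEC IV.4.4, as printed: `[p](t) = p·f(t) + g(t^p)`.** [Silverman AEC IV.4.4]
[cite: SilvermanAEC2009, IV.4.4] -/
theorem formalMul_prime_eq_add_subst_X_pow :
    W.formalMul p = C (p : ℚ_[p]) * W.formalMulPRemPart + (W.formalMulPDivPart).subst (X ^ p) := by
  have hp : p.Prime := Fact.out
  have hp0 : (p : ℚ_[p]) ≠ 0 := Nat.cast_ne_zero.mpr hp.ne_zero
  ext k
  rw [map_add, coeff_C_mul, formalMulPRemPart, coeff_mk, formalMulPDivPart,
    coeff_subst_X_pow hp.ne_zero, coeff_mk]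
  by_cases hk : p ∣ k
  · rw [if_pos hk, if_pos hk, mul_zero, zero_add, Nat.mul_div_cancel' hk, Algebra.algebraMap_self_apply]
  · rw [if_neg hk, if_neg hk, add_zero, ← mul_assoc, mul_inv_cancel₀ hp0, one_mul]

/-- `g ∈ ℤ_p⟦s⟧`. [Silverman AEC IV.4.4] [folklore] -/
theorem isPadicInt_formalMulPDivPart : IsPadicInt W.formalMulPDivPart :=
  isPadicInt_iff_coeff.mpr fun k => by
    rw [formalMulPDivPart, coeff_mk]
    exact isPadicInt_iff_coeff.mp (W.isPadicInt_formalMul p) _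

/-- **`f ∈ ℤ_p⟦t⟧`** — the content of AEC IV.4.4 (`norm_coeff_formalMul_prime_le`).
[Silverman AEC IV.4.4] [cite: SilvermanAEC2009, IV.4.4] -/
theorem isPadicInt_formalMulPRemPart : IsPadicInt W.formalMulPRemPart :=
  isPadicInt_iff_coeff.mpr fun k => by
    rw [formalMulPRemPart, coeff_mk]
    by_cases hk : p ∣ k
    · rw [if_pos hk, norm_zero]; exact zero_le_one
    · have hp : p.Prime := Fact.out
      have hp0 : 0 < ‖(p : ℚ_[p])‖ := norm_pos_iff.mpr (Nat.cast_ne_zero.mpr hp.ne_zero)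
      rw [if_neg hk, norm_mul, norm_inv]
      calc ‖(p : ℚ_[p])‖⁻¹ * ‖coeff k (W.formalMul p)‖ ≤ ‖(p : ℚ_[p])‖⁻¹ * ‖(p : ℚ_[p])‖ :=
            mul_le_mul_of_nonneg_left (W.norm_coeff_formalMul_prime_le hk) (inv_nonneg.mpr hp0.le)
        _ = 1 := inv_mul_cancel₀ hp0.ne'

omit hW in
/-- `g(0) = 0`. [folklore] -/
@[simp] theorem constantCoeff_formalMulPDivPart : constantCoeff W.formalMulPDivPart = 0 := by
  rw [← coeff_zero_eq_constantCoeff_apply, formalMulPDivPart, coeff_mk, mul_zero,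
    coeff_zero_eq_constantCoeff_apply, constantCoeff_formalMul]

omit hW in
/-- `g'(0) = [t^p][p]`. [folklore] -/
theorem coeff_one_formalMulPDivPart : coeff 1 W.formalMulPDivPart = coeff p (W.formalMul p) := by
  rw [formalMulPDivPart, coeff_mk, mul_one]

/-- **`[p](t) ≡ g(t^p) (mod p)` with `g(s) = A_p·s + O(s²) (mod p)`** (`p` odd): modulo `p` the
multiplication by `p` on `Ê` factors through the Frobenius `t ↦ t^p`, and the linear term of the
cofactor (the Verschiebung) is the Hasse invariant. [Silverman AEC IV.4.4, IV.7; Katz–Mazur 1985, 12.4]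
[cite: SilvermanAEC2009, IV.7.1] -/
theorem norm_coeff_one_formalMulPDivPart_sub_hasseCoeff_lt_one (hp2 : p ≠ 2) :
    ‖coeff 1 W.formalMulPDivPart - W.hasseCoeff p‖ < 1 := by
  rw [coeff_one_formalMulPDivPart]
  exact W.norm_coeff_prime_formalMul_sub_hasseCoeff_lt_one hp2

end Decomposition

end WeierstrassCurve
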